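import Mathlib
import HarnessLib
import Literature.Computability.AlgebraicComplexity.TensorRestrictionRank
import Literature.Computability.AlgebraicComplexity.CoppersmithWinograd1990Proofs
import Summits.MatrixMultiplication.MatrixMultiplication.Theses.OutsiderSandwich
import Summits.MatrixMultiplication.MatrixMultiplication.Theorems.OutsiderSandwichPackingProfile
import Summits.MatrixMultiplication.MatrixMultiplication.Theorems.OutsiderSandwichDegenerationWitnessRestrictions
import Summits.MatrixMultiplication.MatrixMultiplication.Theorems.OutsiderSandwichLaserMerge

/-!
# OutsiderSandwich — LASER TANGENCY, I: the item, its rungs, and necessity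
(decomp-mm lens 4 «minimal-counterexample / extremal reduction», gen 10; part Ib
`OutsiderSandwichLaserTangencyOfPerfect.lean`: LNT ⟹ LT; part II `OutsiderSandwichLaserTangencyCut.lean`:
the quantitative law and the exact cut `ω = 2 ⟺ LT ∧ BOTTOM`)

## The node
The route `OutsiderSandwich` decides `ω(ℂ) = 2` as TOP ∧ BOTTOM (`closes`, rev 10): TOP =
`CwTwoMMPerfect` (single products `⟨m,m,m⟩ ≤ cw₂^{⊠N}` with `m² ≥ 3^{(1-ε)N}`), BOTTOM =
`LaserMergeOptimal` (no single product beats the laser-merge line `ℓ(ω) = 2/3 + (2/ω)(log₂3 − 2/3)`).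
Gen 9 replaced TOP by the weaker ω-free LNT = `PerfectBeyondLaser` (perfect PACKINGS `⟨B⟩ ⊗ ⟨m,m,m⟩`
with block side beyond the laser wall `2^{N/3}`).  Gen 10 goes to the end of that road, the item
* `LaserTangency` (LT, stmt-32268): for every `s < 1` there is a multiplicity cap
  `b < b_L := log₂3 − 2/3 = 0.91830…`, chosen before `ε`, such that for every `ε > 0`, cofinally in
  `N`, some packing `⟨B⟩ ⊗ ⟨m,m,m⟩ ≤ cw₂^{⊠N}` has `B ≤ 2^{bN}` and
  `B^s · m² ≥ 2^{((2/3)(1−s) − ε)N} · 3^{sN}`.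
In profile coordinates `β = log₂B/N`, `μ = 2log₂m/N` this reads `μ − 2/3 ≥ s·(b_L − β) − ε`: the
EXCESS RATIO `ρ := (μ − 2/3)/(b_L − β)` of capped packings accumulates at `1`, i.e. achievable
packings approach the laser point `(b_L, 2/3)` tangentially to the flattening ceiling `μ ≤ log₂3 − β`.
Dictionary to Coppersmith–Winograd's VALUE (arXiv:2010.05846 §3): `LT(s)` says the laser value bound
`V_τ(cw₂^{⊠N}) ≥ (3·2^{(τ−2)/3})^N` at `τ = 2/s` is attained, up to `2^{−εN}`, by EQUAL-BLOCK
restrictions whose MULTIPLICITY IS CAPPED strictly below the laser multiplicity `(27/4)^{N/3}` — the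
cap is the lever (uncapped, the laser packing itself witnesses every `s`; with `∀ ε ∃ b` the statement
is equally empty).  Spectral reading (Strassen1988): with `φ(F) := log₂F(cw₂) − b_L − τ_F/3 ≥ 0` the
laser slack of a spectral point `F` (`F(⟨m,m,m⟩) = m^{τ_F}`), LT ⟺ the zero set of `φ` lies in
`{τ_F = 2}`; LNT(γ) ⟺ `φ ≥ γ'(τ_F − 2)`; TOP ⟺ `φ ≥ 0.459(τ_F − 2)`; BOTTOM ⟺ `φ(F) = 0` for some
`F` with `τ_F = ω`.

## Proved here
* `laserTangencyAt_of_omega_le`, `laserTangencyAt_of_lt_two_div_omega`: unconditionally `LT(s)` with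
  cap `b = 0` for every `s < 2/ω` (laser merging) — so the tangency threshold
  `s*(cw₂) := sup {s : LT(s)}` is `≥ 2/ω`; part II shows BOTTOM makes it exactly `2/ω`.
* `laserTangency_rung` = item `LaserTangencyRung` (stmt-32271): hypothesis-free `LT(s)` for all
  `s < 2/2.37295 = 0.84283…` (tree `LeGall2014_cw4_omega_le`).
* `laserTangency_of_summit`, `laserMergeOptimal_of_summit`: `ω = 2 ⟹ LT`, `ω = 2 ⟹ BOTTOM`.
* (part Ib) `laserTangency_of_perfectBeyondLaser` = item `LaserTangencyOfPerfectBeyondLaser` (stmt-32269):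
  LNT ⟹ LT; with gen 9's TOP ⟹ LNT, LT is WEAKER-OR-EQUAL than LNT and TOP.

Instrument (census hand K13): the EXCESS-RATIO TABLE `ρ = (2log₂m/N − 2/3)/(0.91830 − log₂B/N)` over
certified packings — `I(2,2)` (`N=2, B=1, m=2`): 0.363 · `I(3,3)`: 0.425 · laser level one
(`N=3, B=2, m=2`): 0 · HalfMM rate `4^{log₆3}`: 0.609 (asymptotic) · laser + Le Gall merge: 0.8428
(asymptotic, `laserTangency_rung`) · print ceiling 0.8434 (`ω < 2.371339`).  Under BOTTOM any
explicit family with excess ratio `ρ` is the exponent bound `ω ≤ 2/ρ` (part II).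

Sources: CoppersmithWinograd1990 (§6 laser, §7 value); BurgisserClausenShokrollahi1997 (Thm. 15.41,
§15.5); Schonhage1981 (merging); Blaser2013 (Lemma 7.1 flattening); Strassen1988, Strassen1991
(asymptotic spectrum); AlmanVassilevskaWilliams2018, arXiv:2010.05846 §3 (value `V_τ`);
ChristandlVranaZuiddam2021 (irreversibility barrier — not met: no rank bound on cw₂ is used);
LeGall2014 (`ω ≤ 2.37295`, tree).
-/

set_option linter.dupNamespace false

namespace Summit.MatrixMultiplication.MatrixMultiplication.Theorems.OutsiderSandwichLaserTangency

open scoped BigOperators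
open Literature.Computability.AlgebraicComplexity
open Summit.MatrixMultiplication.MatrixMultiplication.Theses.OutsiderSandwich
  (LaserMergeOptimal LaserTangency LaserTangencyRung)
open Summit.MatrixMultiplication.MatrixMultiplication.Theorems.OutsiderSandwichPackingProfile
  (matMul_restrictsTo_unitOne_kronecker)
open Summit.MatrixMultiplication.MatrixMultiplication.Theorems.OutsiderSandwichDegenerationWitness
  (sq_le_three_pow_of_mm)
open Summit.MatrixMultiplication.MatrixMultiplication.Theorems.OutsiderSandwichLaserMerge
  (cwTwoRateLaserMerge_holds cwTwoRate_of_omega_le)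

/-! ## Rates as LT instances -/

/-- `2^{(2/3)(1-s)} · 3^s = 2^{2/3 + s(log₂3 − 2/3)}`. [folklore] -/
theorem rate_eq (s : ℝ) :
    (2 : ℝ) ^ (2 / 3 * (1 - s)) * (3 : ℝ) ^ s = (2 : ℝ) ^ (2 / 3 + s * (Real.logb 2 3 - 2 / 3)) := by
  have h3 : (3 : ℝ) ^ s = (2 : ℝ) ^ (Real.logb 2 3 * s) := by
    rw [Real.rpow_mul (by norm_num : (0 : ℝ) ≤ 2),
      Real.rpow_logb (by norm_num) (by norm_num) (by norm_num)]
  rw [h3, ← Real.rpow_add two_pos]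
  congr 1; ring

/-- **A single-product rate `c_s = 2^{(2/3)(1-s)}·3^s` gives the `LT(s)` instance with `b = 0`,
`B = 1`.** [this route, g10] -/
theorem laserTangencyAt_of_rate {s : ℝ}
    (h : ∀ N₀ : ℕ, ∃ N : ℕ, N₀ ≤ N ∧ ∃ m : ℕ,
      TensorRestrictsTo (kroneckerPow (cwTensor ℂ 2) N) (matMulTensor ℂ m m m) ∧
        ((2 : ℝ) ^ (2 / 3 * (1 - s)) * (3 : ℝ) ^ s) ^ N ≤ (m : ℝ) ^ 2)
    {ε : ℝ} (hε : 0 ≤ ε) (N₀ : ℕ) :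
    ∃ N : ℕ, N₀ ≤ N ∧ ∃ B m : ℕ,
      TensorRestrictsTo (kroneckerPow (cwTensor ℂ 2) N)
          (kroneckerTensor (unitTensor ℂ B) (matMulTensor ℂ m m m)) ∧
        (B : ℝ) ≤ (2 : ℝ) ^ ((0 : ℝ) * N) ∧
        (2 : ℝ) ^ ((2 / 3 * (1 - s) - ε) * N) * (3 : ℝ) ^ (s * N) ≤ (B : ℝ) ^ s * (m : ℝ) ^ 2 := by
  obtain ⟨N, hN, m, hres, hle⟩ := h N₀
  refine ⟨N, hN, 1, m, hres.trans (matMul_restrictsTo_unitOne_kronecker m), by simp, ?_⟩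
  rw [Nat.cast_one, Real.one_rpow, one_mul]
  refine le_trans ?_ hle
  have key : ((2 : ℝ) ^ (2 / 3 * (1 - s)) * (3 : ℝ) ^ s) ^ N =
      (2 : ℝ) ^ (2 / 3 * (1 - s) * N) * (3 : ℝ) ^ (s * N) := by
    rw [mul_pow, ← Real.rpow_natCast ((2 : ℝ) ^ (2 / 3 * (1 - s))) N,
      ← Real.rpow_natCast ((3 : ℝ) ^ s) N, ← Real.rpow_mul (by norm_num : (0 : ℝ) ≤ 2),
      ← Real.rpow_mul (by norm_num : (0 : ℝ) ≤ 3)]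
  rw [key]
  refine mul_le_mul_of_nonneg_right ?_ (Real.rpow_nonneg (by norm_num) _)
  refine Real.rpow_le_rpow_of_exponent_le one_le_two ?_
  nlinarith [Nat.cast_nonneg (α := ℝ) N, hε]

/-- **Every upper bound `ω ≤ ω'` gives the `LT(s)` instance (`b = 0`, `B = 1`) for every
`s < 2/ω'`** (`ℓ` is antitone in `ω`; laser merging at exponent `ω'`). [this route, g5+g10] -/
theorem laserTangencyAt_of_omega_le {ω' : ℝ} (hω' : omega ℂ ≤ ω') {s : ℝ} (hs : s < 2 / ω')
    {ε : ℝ} (hε : 0 ≤ ε) (N₀ : ℕ) :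
    ∃ N : ℕ, N₀ ≤ N ∧ ∃ B m : ℕ,
      TensorRestrictsTo (kroneckerPow (cwTensor ℂ 2) N)
          (kroneckerTensor (unitTensor ℂ B) (matMulTensor ℂ m m m)) ∧
        (B : ℝ) ≤ (2 : ℝ) ^ ((0 : ℝ) * N) ∧
        (2 : ℝ) ^ ((2 / 3 * (1 - s) - ε) * N) * (3 : ℝ) ^ (s * N) ≤ (B : ℝ) ^ s * (m : ℝ) ^ 2 := by
  refine laserTangencyAt_of_rate (fun N₁ => ?_) hε N₀
  have hω0 : 0 < ω' := lt_of_lt_of_le (by linarith [omega_two_le ℂ]) hω'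
  have h1 : 1 < Real.logb 2 3 := by
    rw [Real.lt_logb_iff_rpow_lt (by norm_num) (by norm_num), Real.rpow_one]; norm_num
  have hc0 : 0 ≤ (2 : ℝ) ^ (2 / 3 * (1 - s)) * (3 : ℝ) ^ s :=
    mul_nonneg (Real.rpow_nonneg (by norm_num) _) (Real.rpow_nonneg (by norm_num) _)
  have hc : (2 : ℝ) ^ (2 / 3 * (1 - s)) * (3 : ℝ) ^ s <
      (2 : ℝ) ^ (2 / 3 + 2 / ω' * (Real.logb 2 3 - 2 / 3)) := by
    rw [rate_eq, Real.rpow_lt_rpow_left_iff one_lt_two]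
    have hpos : 0 < Real.logb 2 3 - 2 / 3 := by linarith
    have := mul_lt_mul_of_pos_right hs hpos
    linarith
  exact cwTwoRate_of_omega_le hω' hc0 hc N₁

/-- **Unconditionally, `LT(s)` holds for every `s < 2/ω(ℂ)`** (`b = 0`): the tangency threshold of
`cw₂` is at least `2/ω`; `omega_le_of_laserTangencyAt` says BOTTOM makes it exactly `2/ω`.
[this route, g10] -/
theorem laserTangencyAt_of_lt_two_div_omega {s : ℝ} (hs : s < 2 / omega ℂ) {ε : ℝ} (hε : 0 ≤ ε)
    (N₀ : ℕ) :
    ∃ N : ℕ, N₀ ≤ N ∧ ∃ B m : ℕ,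
      TensorRestrictsTo (kroneckerPow (cwTensor ℂ 2) N)
          (kroneckerTensor (unitTensor ℂ B) (matMulTensor ℂ m m m)) ∧
        (B : ℝ) ≤ (2 : ℝ) ^ ((0 : ℝ) * N) ∧
        (2 : ℝ) ^ ((2 / 3 * (1 - s) - ε) * N) * (3 : ℝ) ^ (s * N) ≤ (B : ℝ) ^ s * (m : ℝ) ^ 2 :=
  laserTangencyAt_of_omega_le le_rfl hs hε N₀

/-- **The hypothesis-free rung of LT**: `LT(s)` with `b = 0` for every `s < 2/2.37295 = 0.8428…`
(Le Gall's kernel bound `ω ≤ 2.37295`, tree `LeGall2014_cw4_omega_le`). [cite: LeGall2014, Table 2] -/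
theorem laserTangency_rung {s : ℝ} (hs : s < 2 / 2.37295) {ε : ℝ} (hε : 0 ≤ ε) (N₀ : ℕ) :
    ∃ N : ℕ, N₀ ≤ N ∧ ∃ B m : ℕ,
      TensorRestrictsTo (kroneckerPow (cwTensor ℂ 2) N)
          (kroneckerTensor (unitTensor ℂ B) (matMulTensor ℂ m m m)) ∧
        (B : ℝ) ≤ (2 : ℝ) ^ ((0 : ℝ) * N) ∧
        (2 : ℝ) ^ ((2 / 3 * (1 - s) - ε) * N) * (3 : ℝ) ^ (s * N) ≤ (B : ℝ) ^ s * (m : ℝ) ^ 2 :=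
  laserTangencyAt_of_omega_le (LeGall2014_cw4_omega_le ℂ) hs hε N₀

/-! ## NECESSITY: `ω = 2 ⟹ LT`, `ω = 2 ⟹ BOTTOM` -/

/-- **`ω(ℂ) = 2 ⟹ LT`** (`b = 0`, `B = 1`: under `ω = 2` laser-merging gives every rate `c < 3`,
i.e. `LT(s)` for every `s < 2/2 = 1`). [cite: BurgisserClausenShokrollahi1997, Thm. 15.41 and §15.5] -/
theorem laserTangency_of_summit (hS : _root_.MatrixMultiplication) : LaserTangency := by
  have hω : omega ℂ = 2 := by rwa [_root_.MatrixMultiplication_iff] at hS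
  intro s hs0 hs1
  have h1 : 1 < Real.logb 2 3 := by
    rw [Real.lt_logb_iff_rpow_lt (by norm_num) (by norm_num), Real.rpow_one]; norm_num
  refine ⟨0, by linarith, fun ε hε N₀ => ?_⟩
  exact laserTangencyAt_of_lt_two_div_omega (by rw [hω, lt_div_iff₀ two_pos]; linarith) hε.le N₀

/-- **`ω(ℂ) = 2 ⟹ BOTTOM`** (flattening: `ℓ(2) = log₂ 3`). [folklore] -/
theorem laserMergeOptimal_of_summit (hS : _root_.MatrixMultiplication) : LaserMergeOptimal := by
  have hω : omega ℂ = 2 := by rwa [_root_.MatrixMultiplication_iff] at hS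
  intro ε hε
  refine ⟨0, fun N _ m hm => ?_⟩
  have h3 : (m : ℝ) ^ 2 ≤ (3 : ℝ) ^ (N : ℝ) := by
    rw [Real.rpow_natCast]; exact_mod_cast sq_le_three_pow_of_mm hm
  refine h3.trans ?_
  rw [hω, show (3 : ℝ) ^ (N : ℝ) = (2 : ℝ) ^ (Real.logb 2 3 * N) by
    rw [Real.rpow_mul (by norm_num), Real.rpow_logb (by norm_num) (by norm_num) (by norm_num)]]
  refine Real.rpow_le_rpow_of_exponent_le one_le_two ?_
  have : (0 : ℝ) ≤ N := Nat.cast_nonneg N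
  nlinarith

/-! ## The route item, by name (rev 10) -/

/-- **Item `OutsiderSandwich.LaserTangencyRung` (stmt-MatrixMultiplication-32271) holds**: `LT(s)`
hypothesis-free for `s < 2/2.37295`. [this route, g10] -/
theorem laserTangencyRung_holds : LaserTangencyRung := fun _ hs _ hε N₀ => laserTangency_rung hs hε N₀

end Summit.MatrixMultiplication.MatrixMultiplication.Theorems.OutsiderSandwichLaserTangency
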